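import Mathlib
import HarnessLib
import Literature.Analysis.FluidPDE.ClassicalSolution
import Literature.Analysis.FluidPDE.LerayHopf
import Literature.Analysis.FluidPDE.SuitableWeak
import Summits.NavierStokesRegularity.NavierStokesRegularity.Theses.QuarterJolt
import Summits.NavierStokesRegularity.NavierStokesRegularity.Theses.HodographBetchov
import Summits.NavierStokesRegularity.NavierStokesRegularity.Theorems.QuarterJoltNoTerminalJoltRegularTime
import Summits.NavierStokesRegularity.NavierStokesRegularity.Theorems.QuarterJoltEnergyJumpLaw
import Summits.NavierStokesRegularity.NavierStokesRegularity.Theorems.QuarterJoltEnergyJumpDefect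
import Summits.NavierStokesRegularity.NavierStokesRegularity.Theorems.QuarterJoltTypeIEnergyEqualityPosition
import Summits.NavierStokesRegularity.NavierStokesRegularity.Theorems.HodographBetchovFastClassSqueezeNoConcentration

/-!
# Route QuarterJolt — crux `NoTerminalJolt` (stmt-NavierStokesRegularity-26463), LEAD line
# `regular_split` rev 5: typed edges of stub 3 — «no energy jump at non-Type-I first blow-ups» is
# exactly «Leray's energy equality on every closed frame interval», and implies stmt-18118 BY NAME

Seat ns-ntj-p1 g4 (LEAD of the crux; `--supports 26463 --as helper`). After the Type-I energy equality
(`tendsto_eLpNorm_sub_of_isTypeIBlowup`, p639359) and the regular-time theorem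
(`noTerminalJolt_of_hasSmoothExtensionPast`, p619494), stub `stub_typeIIEnergyEquality` of
`Cruxes/NoTerminalJolt/Lines/regular_split.lean` — stated only at NON-Type-I FIRST BLOW-UP times — is
equivalent to the GLOBAL statement «every frame solution (classical on `[0,T)`, Leray–Hopf on `[0,T]`,
rapidly decaying datum) is strongly `L²`-continuous into `T`», i.e. «Leray's energy equality
`E(u T) + ν∫₀ᵀ∫|∇u|²_F = E(u 0)` holds on EVERY closed frame interval» (`QuarterJoltEnergyJumpDefect`,
p632964); and it implies the shelf statement stmt-18118 `HodographBetchov.NoFastEnergyConcentration`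
BY NAME (via `FastClassSqueeze.Birth.stub_no_fast_energy_concentration_of_tendsto`).

* `energyContinuousEverywhere_of_typeIIEnergyEquality`, `typeIIEnergyEquality_iff_energyContinuousEverywhere`;
* `lerayEnergyEqualityEverywhere_of_typeIIEnergyEquality`;
* `noFastEnergyConcentration_of_typeIIEnergyEquality : stub 3 → Theses.HodographBetchov.NoFastEnergyConcentration`.

HONEST FRAMING: typed edges between OPEN statements (stub 3, stmt-18118); nothing is asserted about
them; Navier–Stokes regularity is OPEN. No summit statement is proved here. [folklore]
-/

noncomputable section

-- the summit and its single sub-problem share the name (CONVENTIONS §1), as in every Theorems file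
set_option linter.dupNamespace false

namespace Summit.NavierStokesRegularity.NavierStokesRegularity.Theorems

open MeasureTheory Set Function Filter Topology InnerProductSpace
open scoped ENNReal NNReal
open Literature.Analysis.FluidPDE

namespace NoTerminalJolt

/-- **Stub 3 ⇒ every frame solution is strongly `L²`-continuous into its terminal time.** From «no
energy jump at non-Type-I first blow-ups» (stub `stub_typeIIEnergyEquality`, verbatim as hypothesis):
for every frame solution `‖u(t) − u(T)‖_{L²} → 0` as `t ↑ T` — regular times by
`noTerminalJolt_of_hasSmoothExtensionPast` + the energy-jump law, Type-I first blow-ups by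
`tendsto_eLpNorm_sub_of_isTypeIBlowup`, the rest by the stub. [folklore] -/
theorem energyContinuousEverywhere_of_typeIIEnergyEquality
    (h : ∀ (ν T : ℝ), 0 < ν → 0 < T →
      ∀ (u : ℝ → EuclideanSpace ℝ (Fin 3) → EuclideanSpace ℝ (Fin 3))
        (p : ℝ → EuclideanSpace ℝ (Fin 3) → ℝ),
        Literature.Analysis.FluidPDE.IsMaximalSmoothSolution ν 0 u p T →
        Literature.Analysis.FluidPDE.IsLerayHopfOn T ν 0 (u 0) u →
        Literature.Analysis.FluidPDE.HasRapidSpatialDecay (u 0) →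
        ¬ Literature.Analysis.FluidPDE.IsTypeIBlowup u T →
        Filter.Tendsto (fun t => MeasureTheory.eLpNorm (u t - u T) 2 MeasureTheory.volume)
          (nhdsWithin T (Set.Iio T)) (nhds 0)) :
    ∀ (ν T : ℝ), 0 < ν → 0 < T →
      ∀ (u : ℝ → EuclideanSpace ℝ (Fin 3) → EuclideanSpace ℝ (Fin 3))
        (p : ℝ → EuclideanSpace ℝ (Fin 3) → ℝ),
        Literature.Analysis.FluidPDE.IsClassicalNSSolutionOn (Set.Ico 0 T) ν 0 u p →
        Literature.Analysis.FluidPDE.IsLerayHopfOn T ν 0 (u 0) u →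
        Literature.Analysis.FluidPDE.HasRapidSpatialDecay (u 0) →
        Filter.Tendsto (fun t => MeasureTheory.eLpNorm (u t - u T) 2 MeasureTheory.volume)
          (nhdsWithin T (Set.Iio T)) (nhds 0) := by
  intro ν T hν hT u p hcl hLH hdec
  by_cases hext : HasSmoothExtensionPast ν 0 u T
  · exact tendsto_eLpNorm_sub_of_tendsto_joltFunctional hT hLH
      (noTerminalJolt_of_hasSmoothExtensionPast hν hT hcl hLH hdec hext)
  · by_cases hTI : IsTypeIBlowup u T
    · exact tendsto_eLpNorm_sub_of_isTypeIBlowup hν hT hcl hLH hdec hTI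
    · exact h ν T hν hT u p ⟨hcl, hext⟩ hLH hdec hTI

/-- **Stub 3 ⟺ «every frame solution is strongly `L²`-continuous into its terminal time»** (the
converse is weakening). Exactness of the bookkeeping: the only open content of «energy continuity at
every frame time» is the enstrophy-heavy non-Type-I first blow-up. Both sides OPEN. [folklore] -/
theorem typeIIEnergyEquality_iff_energyContinuousEverywhere :
    (∀ (ν T : ℝ), 0 < ν → 0 < T →
      ∀ (u : ℝ → EuclideanSpace ℝ (Fin 3) → EuclideanSpace ℝ (Fin 3))
        (p : ℝ → EuclideanSpace ℝ (Fin 3) → ℝ),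
        Literature.Analysis.FluidPDE.IsMaximalSmoothSolution ν 0 u p T →
        Literature.Analysis.FluidPDE.IsLerayHopfOn T ν 0 (u 0) u →
        Literature.Analysis.FluidPDE.HasRapidSpatialDecay (u 0) →
        ¬ Literature.Analysis.FluidPDE.IsTypeIBlowup u T →
        Filter.Tendsto (fun t => MeasureTheory.eLpNorm (u t - u T) 2 MeasureTheory.volume)
          (nhdsWithin T (Set.Iio T)) (nhds 0)) ↔
    (∀ (ν T : ℝ), 0 < ν → 0 < T →
      ∀ (u : ℝ → EuclideanSpace ℝ (Fin 3) → EuclideanSpace ℝ (Fin 3))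
        (p : ℝ → EuclideanSpace ℝ (Fin 3) → ℝ),
        Literature.Analysis.FluidPDE.IsClassicalNSSolutionOn (Set.Ico 0 T) ν 0 u p →
        Literature.Analysis.FluidPDE.IsLerayHopfOn T ν 0 (u 0) u →
        Literature.Analysis.FluidPDE.HasRapidSpatialDecay (u 0) →
        Filter.Tendsto (fun t => MeasureTheory.eLpNorm (u t - u T) 2 MeasureTheory.volume)
          (nhdsWithin T (Set.Iio T)) (nhds 0)) :=
  ⟨energyContinuousEverywhere_of_typeIIEnergyEquality,
    fun h ν T hν hT u p hmax hLH hdec _ => h ν T hν hT u p hmax.1 hLH hdec⟩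

/-- **Stub 3 ⇒ Leray's energy equality on EVERY closed frame interval**: `E(u T) + ν∫₀ᵀ∫|∇u|²_F = E(u 0)`
for every frame solution and every `T` (`tendsto_eLpNorm_sub_iff_energyEquality`, p632964). [folklore] -/
theorem lerayEnergyEqualityEverywhere_of_typeIIEnergyEquality
    (h : ∀ (ν T : ℝ), 0 < ν → 0 < T →
      ∀ (u : ℝ → EuclideanSpace ℝ (Fin 3) → EuclideanSpace ℝ (Fin 3))
        (p : ℝ → EuclideanSpace ℝ (Fin 3) → ℝ),
        Literature.Analysis.FluidPDE.IsMaximalSmoothSolution ν 0 u p T →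
        Literature.Analysis.FluidPDE.IsLerayHopfOn T ν 0 (u 0) u →
        Literature.Analysis.FluidPDE.HasRapidSpatialDecay (u 0) →
        ¬ Literature.Analysis.FluidPDE.IsTypeIBlowup u T →
        Filter.Tendsto (fun t => MeasureTheory.eLpNorm (u t - u T) 2 MeasureTheory.volume)
          (nhdsWithin T (Set.Iio T)) (nhds 0)) :
    ∀ (ν T : ℝ), 0 < ν → 0 < T →
      ∀ (u : ℝ → EuclideanSpace ℝ (Fin 3) → EuclideanSpace ℝ (Fin 3))
        (p : ℝ → EuclideanSpace ℝ (Fin 3) → ℝ),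
        Literature.Analysis.FluidPDE.IsClassicalNSSolutionOn (Set.Ico 0 T) ν 0 u p →
        Literature.Analysis.FluidPDE.IsLerayHopfOn T ν 0 (u 0) u →
        Literature.Analysis.FluidPDE.HasRapidSpatialDecay (u 0) →
        VectorCalculus.kineticEnergy (u T) +
          ν * (∫⁻ τ in Set.Ioo 0 T, ∫⁻ x,
            ENNReal.ofReal (frobeniusNormSq (fderiv ℝ (u τ) x))).toReal =
          VectorCalculus.kineticEnergy (u 0) :=
  fun ν T hν hT u p hcl hLH hdec =>
    (tendsto_eLpNorm_sub_iff_energyEquality hν hT hcl hLH).1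
      (energyContinuousEverywhere_of_typeIIEnergyEquality h ν T hν hT u p hcl hLH hdec)

/-- **Stub 3 ⇒ `HodographBetchov.NoFastEnergyConcentration` (stmt-18118) BY NAME**: no energy jump at
non-Type-I first blow-ups implies — with the Type-I energy equality and the regular-time theorem — that
the kinetic energy of every frame solution is uniformly integrable over speed classes up to `T`
(`FastClassSqueeze.Birth.stub_no_fast_energy_concentration_of_tendsto`). A typed edge from a registered
OPEN stub of route QuarterJolt to an OPEN crux of route HodographBetchov; nothing is asserted about
either. [folklore] -/
theorem noFastEnergyConcentration_of_typeIIEnergyEquality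
    (h : ∀ (ν T : ℝ), 0 < ν → 0 < T →
      ∀ (u : ℝ → EuclideanSpace ℝ (Fin 3) → EuclideanSpace ℝ (Fin 3))
        (p : ℝ → EuclideanSpace ℝ (Fin 3) → ℝ),
        Literature.Analysis.FluidPDE.IsMaximalSmoothSolution ν 0 u p T →
        Literature.Analysis.FluidPDE.IsLerayHopfOn T ν 0 (u 0) u →
        Literature.Analysis.FluidPDE.HasRapidSpatialDecay (u 0) →
        ¬ Literature.Analysis.FluidPDE.IsTypeIBlowup u T →
        Filter.Tendsto (fun t => MeasureTheory.eLpNorm (u t - u T) 2 MeasureTheory.volume)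
          (nhdsWithin T (Set.Iio T)) (nhds 0)) :
    Theses.HodographBetchov.NoFastEnergyConcentration :=
  fun ν T hν hT u p hcl hLH hdec =>
    FastClassSqueeze.Birth.stub_no_fast_energy_concentration_of_tendsto ν T hν hT u p hcl hLH hdec
      (energyContinuousEverywhere_of_typeIIEnergyEquality h ν T hν hT u p hcl hLH hdec)

end NoTerminalJolt

end Summit.NavierStokesRegularity.NavierStokesRegularity.Theorems

end
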